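import Mathlib
import HarnessLib
import Summits.Ventures.LatticeQCDFlow.Scaling.AcceptanceGiniFloorIntegral

/-!
# LatticeQCDFlow / Scaling — the Gini mean difference is pinned to the standard deviation:
# `σ/√6 ≤ ½·E|T − T′| ≤ σ/√3` (lower: kurtosis `≤ 3`; upper: Glasser), hence a TWO-SIDED law for
# the strong-coupling acceptance slope of the untrained sampler

HONEST FRAMING: exact (Metropolis-corrected) sampling algorithms for lattice gauge theory;
figures of merit are autocorrelation/cost numbers at stated couplings and volumes; no
continuum-physics claim.

Venture `LatticeQCDFlow` (cell pub-lqcd), topic `Scaling`; FANOUT row 3 (`s0-u1-a`, S0-B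
implementation A, GEN-18).  NEW WORK of the cell (moment inequalities), not a published result; NO
definition is introduced.  Imports the cell's general-space Glasser inequality
`Scaling/AcceptanceGiniFloorIntegral.three_mul_sq_sub_overlap_add_sq_le` (GEN-9).

Row 3's first-order strong-coupling law (`Scaling/IdentityFlowAcceptanceStrongCoupling`, GEN-17)
says the untrained sampler's acceptance leaves `1` with slope `s = ½·E_{μ⊗μ}|T − T′|` (half the
Gini mean difference of the tilt statistic under the proposal law), and bounds `s ≤ σ_T/√2` by
Cauchy–Schwarz.  This file pins `s` to `σ_T` from BOTH sides:

* §1 `three_mul_sq_mul_sq_le` (pointwise `3k²t² ≤ 2k³|t| + t⁴`), **`lyapunov_integral_sq_pow_three_le`**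
  — Lyapunov's moment inequality `(∫S²)³ ≤ (∫|S|)²·∫S⁴` on any measure space, by integrating the
  pointwise inequality at `k = ∫S²/∫|S|` (no Hölder machinery);
* §2 for a probability law `μ` and `T ∈ L⁴(μ)` with mean `m`, variance `σ²` and fourth central
  moment `μ₄ = E(T − m)⁴`: `integral_prod_abs_sub_eq` (`E_{μ⊗μ}|T−T′|` = the iterated integral),
  **`integral_prod_sub_sq_eq`** `E(T−T′)² = 2σ²`, **`integral_prod_sub_pow_four_eq`**
  `E(T−T′)⁴ = 2μ₄ + 6σ⁴`, hence **`four_mul_variance_pow_three_le`**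
  `4σ⁶ ≤ (E|T−T′|)²·(μ₄ + 3σ⁴)` and, when `μ₄ ≤ 3σ⁴` (kurtosis at most Gaussian),
  **`sqrt_variance_div_six_le_half_integral_abs_sub`**: `√(σ²/6) ≤ ½·E|T − T′|`;
* §3 **`three_mul_sq_half_integral_abs_sub_le_variance`** — GLASSER: `3·(½E|T−T′|)² ≤ σ²` for every
  `T ∈ L²` bounded below (the tree's inequality at `q ≡ 1`, `w = T − C`), i.e.
  **`half_integral_abs_sub_le_sqrt_variance_div_three`**: `½·E|T − T′| ≤ √(σ²/3)` — sharper than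
  GEN-17's `√(σ²/2)`;
* §4 **`gini_halfMeanDifference_sandwich`** — both at once: `√(σ²/6) ≤ ½E|T−T′| ≤ √(σ²/3)`.

Reading for the cell (value-free): the first-order coefficient of the untrained sampler's acceptance
deficit is, up to a factor in `[1/√6, 1/√3] ≈ [0.408, 0.577]`, the standard deviation of the action
under the proposal law, whenever the action is platykurtic (sums of independent bounded plaquette
terms are: `Scaling/KurtosisIndependentSum`); the U(1) volume law `√(V/12) ≤ s_V ≤ √(V/6)` is read off
in `Scaling/U1IdentityFlowSlopeVolumeLaw`.  [folklore: Lyapunov 1901 / Hardy–Littlewood–Pólya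
*Inequalities* Thm 17 (§2.9); Glasser 1962 (`√3·G ≤ CV`); no source is relied on — both are proved.]
-/

noncomputable section

namespace Summit.Ventures.LatticeQCDFlow.Theory2

open MeasureTheory ProbabilityTheory Real Set

/-! ## §1 Lyapunov's inequality `(∫S²)³ ≤ (∫|S|)²·∫S⁴` -/

section Lyapunov

variable {Ω : Type*} [MeasurableSpace Ω] {μ : Measure Ω} {S : Ω → ℝ}

/-- Pointwise: `3k²t² ≤ 2k³|t| + t⁴` for `k ≥ 0` (`t⁴ − 3k²t² + 2k³|t| = |t|(|t| − k)²(|t| + 2k)`).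
[folklore] -/
theorem three_mul_sq_mul_sq_le {k : ℝ} (hk : 0 ≤ k) (t : ℝ) :
    3 * k ^ 2 * t ^ 2 ≤ 2 * k ^ 3 * |t| + t ^ 4 := by
  have hu : 0 ≤ |t| := abs_nonneg t
  have e2 : t ^ 2 = |t| ^ 2 := (sq_abs t).symm
  have e4 : t ^ 4 = |t| ^ 4 := by
    rw [show t ^ 4 = (t ^ 2) ^ 2 by ring, e2]; ring
  rw [e2, e4]
  nlinarith [mul_nonneg (mul_nonneg hu (sq_nonneg (|t| - k))) (by linarith : 0 ≤ |t| + 2 * k)]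

/-- **LYAPUNOV'S INEQUALITY** (exponents `1 < 2 < 4`): `(∫S²)³ ≤ (∫|S|)²·∫S⁴` on any measure space
(integrate `3k²S² ≤ 2k³|S| + S⁴` at `k = ∫S²/∫|S|`).  Equivalently `E|S| ≥ (ES²)^{3/2}/(ES⁴)^{1/2}`.
[folklore: Hardy–Littlewood–Pólya, *Inequalities*, Thm 17] -/
theorem lyapunov_integral_sq_pow_three_le (h1 : Integrable (fun x => |S x|) μ)
    (h2 : Integrable (fun x => S x ^ 2) μ) (h4 : Integrable (fun x => S x ^ 4) μ) :
    (∫ x, S x ^ 2 ∂μ) ^ 3 ≤ (∫ x, |S x| ∂μ) ^ 2 * ∫ x, S x ^ 4 ∂μ := by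
  set I1 : ℝ := ∫ x, |S x| ∂μ with hI1
  set I2 : ℝ := ∫ x, S x ^ 2 ∂μ with hI2
  set I4 : ℝ := ∫ x, S x ^ 4 ∂μ with hI4
  have hI1n : 0 ≤ I1 := integral_nonneg fun x => abs_nonneg _
  have hI2n : 0 ≤ I2 := integral_nonneg fun x => sq_nonneg _
  have hI4n : 0 ≤ I4 := integral_nonneg fun x => by positivity
  have key : ∀ k : ℝ, 0 ≤ k → 3 * k ^ 2 * I2 ≤ 2 * k ^ 3 * I1 + I4 := fun k hk => by
    calc 3 * k ^ 2 * I2 = ∫ x, 3 * k ^ 2 * S x ^ 2 ∂μ := by rw [integral_const_mul]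
      _ ≤ ∫ x, (2 * k ^ 3 * |S x| + S x ^ 4) ∂μ :=
          integral_mono (h2.const_mul _) ((h1.const_mul _).add h4)
            fun x => three_mul_sq_mul_sq_le hk (S x)
      _ = 2 * k ^ 3 * I1 + I4 := by rw [integral_add (h1.const_mul _) h4, integral_const_mul]
  by_cases hz : I1 = 0
  · have hae : (fun x => |S x|) =ᵐ[μ] 0 :=
      (integral_eq_zero_iff_of_nonneg (fun x => abs_nonneg (S x)) h1).1 hz
    have h2z : I2 = 0 := by
      have h' : (fun x => S x ^ 2) =ᵐ[μ] fun _ => 0 := hae.mono fun x hx => by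
        have hx' : |S x| = 0 := hx
        simp only [abs_eq_zero] at hx'
        simp [hx']
      rw [hI2, integral_congr_ae h', integral_zero]
    rw [h2z]
    simp only [ne_eq, OfNat.ofNat_ne_zero, not_false_eq_true, zero_pow]
    positivity
  · have hp : 0 < I1 := lt_of_le_of_ne hI1n (Ne.symm hz)
    have hk := key (I2 / I1) (div_nonneg hI2n hI1n)
    have e : 3 * (I2 / I1) ^ 2 * I2 - 2 * (I2 / I1) ^ 3 * I1 = I2 ^ 3 / I1 ^ 2 := by
      field_simp
      ring
    have h3 : I2 ^ 3 / I1 ^ 2 ≤ I4 := by linarith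
    rw [div_le_iff₀ (by positivity)] at h3
    linarith [h3]

end Lyapunov

/-! ## §2 Two i.i.d. copies: `E(T−T′)² = 2σ²`, `E(T−T′)⁴ = 2μ₄ + 6σ⁴`, and the lower bound -/

section Product

variable {Ω : Type*} [MeasurableSpace Ω] {μ : Measure Ω} [IsProbabilityMeasure μ] {T : Ω → ℝ}

/-- The iterated form of `E_{μ⊗μ}|T − T′|`. [folklore] -/
theorem integral_prod_abs_sub_eq (hT : Integrable T μ) :
    ∫ z, |T z.1 - T z.2| ∂(μ.prod μ) = ∫ x, ∫ y, |T x - T y| ∂μ ∂μ :=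
  integral_prod _ ((hT.comp_fst μ).sub (hT.comp_snd μ)).abs

/-- **`E_{μ⊗μ}(T − T′)² = 2·Var T`**. [folklore] -/
theorem integral_prod_sub_sq_eq (hT : MemLp T 2 μ) :
    ∫ z, (T z.1 - T z.2) ^ 2 ∂(μ.prod μ) = 2 * variance T μ := by
  have hTi : Integrable T μ := hT.integrable one_le_two
  have i1 : Integrable (fun z : Ω × Ω => T z.1 ^ 2) (μ.prod μ) := (hT.integrable_sq).comp_fst μ
  have i2 : Integrable (fun z : Ω × Ω => T z.2 ^ 2) (μ.prod μ) := (hT.integrable_sq).comp_snd μ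
  have i3 : Integrable (fun z : Ω × Ω => 2 * (T z.1 * T z.2)) (μ.prod μ) :=
    (hTi.mul_prod hTi).const_mul 2
  have e : (fun z : Ω × Ω => (T z.1 - T z.2) ^ 2)
      = fun z => (T z.1 ^ 2 + T z.2 ^ 2) - 2 * (T z.1 * T z.2) := by
    funext z; ring
  have i12 : Integrable (fun z : Ω × Ω => T z.1 ^ 2 + T z.2 ^ 2) (μ.prod μ) := i1.fun_add i2
  rw [e, integral_sub i12 i3, integral_add i1 i2, integral_const_mul,
    integral_fun_fst (fun x => T x ^ 2), integral_fun_snd (fun x => T x ^ 2),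
    integral_prod_mul (fun x => T x) (fun x => T x), probReal_univ, one_smul, variance_eq_sub hT]
  simp only [Pi.pow_apply]
  ring

/-- **`E_{μ⊗μ}(T − T′)⁴ = 2·E(T − m)⁴ + 6·(Var T)²`** (`m = E T`; the odd cross terms vanish after
centring). [folklore] -/
theorem integral_prod_sub_pow_four_eq (hTm : Measurable T) (hT : MemLp T 4 μ) :
    ∫ z, (T z.1 - T z.2) ^ 4 ∂(μ.prod μ)
      = 2 * ∫ x, (T x - ∫ y, T y ∂μ) ^ 4 ∂μ + 6 * (variance T μ) ^ 2 := by
  set m : ℝ := ∫ y, T y ∂μ with hm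
  -- centred variable
  have hA : MemLp (fun x => T x - m) 4 μ := hT.sub (memLp_const m)
  have hAm : Measurable fun x => T x - m := hTm.sub measurable_const
  have hA2 : MemLp (fun x => T x - m) 2 μ := hA.mono_exponent (by norm_num)
  have iA1 : Integrable (fun x => T x - m) μ := hA.integrable (by norm_num)
  have iA2 : Integrable (fun x => (T x - m) ^ 2) μ := hA2.integrable_sq
  have iA3 : Integrable (fun x => (T x - m) ^ 3) μ := by
    have h3 : MemLp (fun x => T x - m) (3 : ENNReal) μ := hA.mono_exponent (by norm_num)
    refine (h3.integrable_norm_pow (by norm_num)).mono' ((hAm.pow_const 3).aestronglyMeasurable)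
      (ae_of_all _ fun x => ?_)
    rw [Real.norm_eq_abs, Real.norm_eq_abs, abs_pow]
  have iA4 : Integrable (fun x => (T x - m) ^ 4) μ := by
    refine (hA.integrable_norm_pow (by norm_num)).congr (ae_of_all _ fun x => ?_)
    simp only [Real.norm_eq_abs]
    exact (Even.pow_abs (by decide : Even 4) (T x - m))
  have hA0 : ∫ x, (T x - m) ∂μ = 0 := by
    rw [integral_sub (hT.integrable (by norm_num)) (integrable_const m), integral_const, probReal_univ,
      one_smul, hm, sub_self]
  have hvar : variance T μ = ∫ x, (T x - m) ^ 2 ∂μ := by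
    rw [hm]; exact variance_eq_integral hTm.aemeasurable
  -- rewrite the integrand through the centred variable
  have e : (fun z : Ω × Ω => (T z.1 - T z.2) ^ 4) = fun z =>
      (((T z.1 - m) ^ 4 + (T z.2 - m) ^ 4) + 6 * ((T z.1 - m) ^ 2 * (T z.2 - m) ^ 2))
        - 4 * ((T z.1 - m) ^ 3 * (T z.2 - m) + (T z.1 - m) * (T z.2 - m) ^ 3) := by
    funext z; ring
  have i40 : Integrable (fun z : Ω × Ω => (T z.1 - m) ^ 4) (μ.prod μ) := iA4.comp_fst μ
  have i04 : Integrable (fun z : Ω × Ω => (T z.2 - m) ^ 4) (μ.prod μ) := iA4.comp_snd μ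
  have i22 : Integrable (fun z : Ω × Ω => (T z.1 - m) ^ 2 * (T z.2 - m) ^ 2) (μ.prod μ) :=
    iA2.mul_prod iA2
  have i31 : Integrable (fun z : Ω × Ω => (T z.1 - m) ^ 3 * (T z.2 - m)) (μ.prod μ) :=
    iA3.mul_prod iA1
  have i13 : Integrable (fun z : Ω × Ω => (T z.1 - m) * (T z.2 - m) ^ 3) (μ.prod μ) :=
    iA1.mul_prod iA3
  have i44 : Integrable (fun z : Ω × Ω => (T z.1 - m) ^ 4 + (T z.2 - m) ^ 4) (μ.prod μ) :=
    i40.fun_add i04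
  have iP : Integrable (fun z : Ω × Ω => ((T z.1 - m) ^ 4 + (T z.2 - m) ^ 4)
      + 6 * ((T z.1 - m) ^ 2 * (T z.2 - m) ^ 2)) (μ.prod μ) := i44.fun_add (i22.const_mul 6)
  have i3113 : Integrable (fun z : Ω × Ω => (T z.1 - m) ^ 3 * (T z.2 - m)
      + (T z.1 - m) * (T z.2 - m) ^ 3) (μ.prod μ) := i31.fun_add i13
  have iQ : Integrable (fun z : Ω × Ω => 4 * ((T z.1 - m) ^ 3 * (T z.2 - m)
      + (T z.1 - m) * (T z.2 - m) ^ 3)) (μ.prod μ) := i3113.const_mul 4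
  rw [e, integral_sub iP iQ, integral_add i44 (i22.const_mul 6), integral_add i40 i04,
    integral_const_mul, integral_const_mul, integral_add i31 i13,
    integral_fun_fst (fun x => (T x - m) ^ 4), integral_fun_snd (fun x => (T x - m) ^ 4),
    integral_prod_mul (fun x => (T x - m) ^ 2) (fun x => (T x - m) ^ 2),
    integral_prod_mul (fun x => (T x - m) ^ 3) (fun x => T x - m),
    integral_prod_mul (fun x => T x - m) (fun x => (T x - m) ^ 3),
    probReal_univ, one_smul, hA0, hvar]
  ring

/-- **LOWER BOUND OF THE GINI MEAN DIFFERENCE BY THE VARIANCE AND THE FOURTH CENTRAL MOMENT**: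
`4·(Var T)³ ≤ (∫∫|T x − T y| dμ dμ)²·(E(T − m)⁴ + 3(Var T)²)` — Lyapunov's inequality for `T − T′`
under `μ ⊗ μ`. [ours] -/
theorem four_mul_variance_pow_three_le (hTm : Measurable T) (hT : MemLp T 4 μ) :
    4 * (variance T μ) ^ 3
      ≤ (∫ x, ∫ y, |T x - T y| ∂μ ∂μ) ^ 2
        * (∫ x, (T x - ∫ y, T y ∂μ) ^ 4 ∂μ + 3 * (variance T μ) ^ 2) := by
  have hT2 : MemLp T 2 μ := hT.mono_exponent (by norm_num)
  have hTi : Integrable T μ := hT.integrable (by norm_num)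
  -- the difference of the two copies is in `L⁴(μ ⊗ μ)`
  have hD : MemLp (fun z : Ω × Ω => T z.1 - T z.2) 4 (μ.prod μ) := (hT.comp_fst μ).sub (hT.comp_snd μ)
  have hDm : Measurable fun z : Ω × Ω => T z.1 - T z.2 :=
    (hTm.comp measurable_fst).sub (hTm.comp measurable_snd)
  have h1 : Integrable (fun z : Ω × Ω => |T z.1 - T z.2|) (μ.prod μ) := (hD.integrable (by norm_num)).abs
  have h2 : Integrable (fun z : Ω × Ω => (T z.1 - T z.2) ^ 2) (μ.prod μ) :=
    (hD.mono_exponent (by norm_num : (2 : ENNReal) ≤ 4)).integrable_sq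
  have h4 : Integrable (fun z : Ω × Ω => (T z.1 - T z.2) ^ 4) (μ.prod μ) := by
    refine (hD.integrable_norm_pow (by norm_num)).congr (ae_of_all _ fun z => ?_)
    simp only [Real.norm_eq_abs]
    exact (Even.pow_abs (by decide : Even 4) (T z.1 - T z.2))
  have hL := lyapunov_integral_sq_pow_three_le h1 h2 h4
  rw [integral_prod_sub_sq_eq hT2, integral_prod_sub_pow_four_eq hTm hT, integral_prod_abs_sub_eq hTi]
    at hL
  nlinarith [hL]

/-- **`√(Var T/6) ≤ ½·∫∫|T x − T y| dμ dμ` WHEN THE KURTOSIS IS AT MOST `3`** (`E(T − m)⁴ ≤ 3(Var T)²`,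
e.g. sums of independent platykurtic terms, `Scaling/KurtosisIndependentSum`). [ours] -/
theorem sqrt_variance_div_six_le_half_integral_abs_sub (hTm : Measurable T) (hT : MemLp T 4 μ)
    (hkurt : ∫ x, (T x - ∫ y, T y ∂μ) ^ 4 ∂μ ≤ 3 * (variance T μ) ^ 2) :
    Real.sqrt (variance T μ / 6) ≤ 1 / 2 * ∫ x, ∫ y, |T x - T y| ∂μ ∂μ := by
  set G : ℝ := ∫ x, ∫ y, |T x - T y| ∂μ ∂μ with hG
  have hG0 : 0 ≤ G := integral_nonneg fun x => integral_nonneg fun y => abs_nonneg _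
  have hV0 : 0 ≤ variance T μ := variance_nonneg T μ
  have h := four_mul_variance_pow_three_le hTm hT
  rw [← hG] at h
  -- `4σ⁶ ≤ G²(μ₄ + 3σ⁴) ≤ 6 G² σ⁴`, hence `σ² ≤ (3/2) G²` when `σ² > 0`
  have h6 : 4 * (variance T μ) ^ 3 ≤ G ^ 2 * (6 * (variance T μ) ^ 2) := by
    calc 4 * (variance T μ) ^ 3 ≤ G ^ 2 * (∫ x, (T x - ∫ y, T y ∂μ) ^ 4 ∂μ + 3 * (variance T μ) ^ 2) := h
      _ ≤ G ^ 2 * (6 * (variance T μ) ^ 2) := by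
          apply mul_le_mul_of_nonneg_left _ (sq_nonneg G); linarith
  have key : variance T μ / 6 ≤ (1 / 2 * G) ^ 2 := by
    rcases eq_or_lt_of_le hV0 with hz | hpos
    · rw [← hz]; simp only [zero_div]; positivity
    · have : 4 * variance T μ ≤ 6 * G ^ 2 := by
        have hsq : 0 < (variance T μ) ^ 2 := by positivity
        nlinarith [h6]
      nlinarith [this]
  calc Real.sqrt (variance T μ / 6) ≤ Real.sqrt ((1 / 2 * G) ^ 2) := Real.sqrt_le_sqrt key
    _ = 1 / 2 * G := Real.sqrt_sq (by positivity)

end Product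

/-! ## §3 Glasser's inequality `3·(½E|T−T′|)² ≤ Var T` for statistics bounded below -/

section Glasser

variable {Ω : Type*} [MeasurableSpace Ω] {μ : Measure Ω} [IsProbabilityMeasure μ] {T : Ω → ℝ}

/-- `∫∫ min(w x, w y) dμ dμ = ∫ w dμ − ½·∫∫|w x − w y| dμ dμ` for an integrable `w` on a probability
space (`min(a,b) = (a+b)/2 − |a−b|/2`, Fubini). [folklore] -/
theorem integral_integral_min_eq_sub_half_abs {w : Ω → ℝ} (hw : Integrable w μ) :
    ∫ x, ∫ y, min (w x) (w y) ∂μ ∂μ = ∫ x, w x ∂μ - 1 / 2 * ∫ x, ∫ y, |w x - w y| ∂μ ∂μ := by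
  have h1 : Integrable (fun z : Ω × Ω => w z.1) (μ.prod μ) := hw.comp_fst μ
  have h2 : Integrable (fun z : Ω × Ω => w z.2) (μ.prod μ) := hw.comp_snd μ
  have hD : Integrable (fun z : Ω × Ω => |w z.1 - w z.2|) (μ.prod μ) := (h1.sub h2).abs
  have hmin : ∀ a b : ℝ, min a b = (a + b) / 2 - |a - b| / 2 := fun a b => by
    rcases le_total a b with h | h
    · rw [min_eq_left h, abs_of_nonpos (sub_nonpos.2 h)]; ring
    · rw [min_eq_right h, abs_of_nonneg (sub_nonneg.2 h)]; ring
  have hM : Integrable (fun z : Ω × Ω => min (w z.1) (w z.2)) (μ.prod μ) := by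
    have e : (fun z : Ω × Ω => min (w z.1) (w z.2)) = fun z => (w z.1 + w z.2) / 2 - |w z.1 - w z.2| / 2 :=
      funext fun z => hmin _ _
    rw [e]; exact ((h1.fun_add h2).div_const 2).sub (hD.div_const 2)
  rw [← integral_prod _ hM]
  have e : (fun z : Ω × Ω => min (w z.1) (w z.2))
      = fun z => (w z.1 + w z.2) / 2 - |w z.1 - w z.2| / 2 := funext fun z => hmin _ _
  have h12 : Integrable (fun z : Ω × Ω => (w z.1 + w z.2) / 2) (μ.prod μ) := (h1.fun_add h2).div_const 2
  rw [e, integral_sub h12 (hD.div_const 2), integral_div, integral_div,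
    integral_add h1 h2, integral_fun_fst (fun x => w x), integral_fun_snd (fun x => w x), probReal_univ,
    one_smul, integral_prod _ hD]
  ring

/-- **GLASSER'S INEQUALITY FOR A STATISTIC BOUNDED BELOW**: `3·(½∫∫|T x − T y| dμ dμ)² ≤ Var T` for
`T ∈ L²(μ)` with `C < T` pointwise — the cell's general-space Glasser inequality
(`Scaling/AcceptanceGiniFloorIntegral.three_mul_sq_sub_overlap_add_sq_le`) read at `q ≡ 1`,
`w = T − C`; variance and mean difference are shift-invariant. [ours] -/
theorem three_mul_sq_half_integral_abs_sub_le_variance (hTm : Measurable T) (hT : MemLp T 2 μ)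
    {C : ℝ} (hC : ∀ x, C < T x) :
    3 * (1 / 2 * ∫ x, ∫ y, |T x - T y| ∂μ ∂μ) ^ 2 ≤ variance T μ := by
  -- the shifted positive weight
  set w : Ω → ℝ := fun x => T x - C with hw
  have hw0 : ∀ x, 0 < w x := fun x => sub_pos.2 (hC x)
  have hwm : Measurable w := hTm.sub measurable_const
  have hW : MemLp w 2 μ := hT.sub (memLp_const C)
  have hwi : Integrable w μ := hW.integrable one_le_two
  have hW₂ : Integrable (fun x => w x / 1 * w x) μ := by
    refine hW.integrable_sq.congr (ae_of_all _ fun x => ?_)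
    simp only [div_one]; ring
  have hq1 : ∫ _z, (1 : ℝ) ∂μ = 1 := by rw [integral_const, probReal_univ, one_smul]
  have hG := three_mul_sq_sub_overlap_add_sq_le (μ := μ) (w := w) (q := fun _ => (1 : ℝ)) hw0 hwm hwi
    (fun _ => one_pos) measurable_const (integrable_const _) hq1 hW₂
  simp only [mul_one, div_one] at hG
  -- translate the three integrals
  have hA : ∫ x, ∫ y, min (w x) (w y) ∂μ ∂μ = ∫ x, w x ∂μ - 1 / 2 * ∫ x, ∫ y, |w x - w y| ∂μ ∂μ :=
    integral_integral_min_eq_sub_half_abs hwi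
  have hdiff : (fun x => ∫ y, |w x - w y| ∂μ) = fun x => ∫ y, |T x - T y| ∂μ := by
    funext x; congr 1; funext y; simp only [hw]; congr 1; ring
  have hvarw : variance w μ = variance T μ := by
    simp only [hw, sub_eq_add_neg]
    exact variance_add_const hT.aestronglyMeasurable (-C)
  have hv : variance T μ = ∫ x, w x * w x ∂μ - (∫ x, w x ∂μ) ^ 2 := by
    rw [← hvarw, variance_eq_sub hW]
    simp only [Pi.pow_apply, sq]
  rw [hA, hdiff] at hG
  rw [hv]
  nlinarith [hG]

/-- Readable form: **`½·∫∫|T x − T y| dμ dμ ≤ √(Var T / 3)`** (GEN-17's Cauchy–Schwarz bound had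
`√(Var T / 2)`). [ours] -/
theorem half_integral_abs_sub_le_sqrt_variance_div_three (hTm : Measurable T) (hT : MemLp T 2 μ)
    {C : ℝ} (hC : ∀ x, C < T x) :
    1 / 2 * ∫ x, ∫ y, |T x - T y| ∂μ ∂μ ≤ Real.sqrt (variance T μ / 3) := by
  have h := three_mul_sq_half_integral_abs_sub_le_variance hTm hT hC
  have h0 : 0 ≤ 1 / 2 * ∫ x, ∫ y, |T x - T y| ∂μ ∂μ :=
    mul_nonneg (by norm_num) (integral_nonneg fun x => integral_nonneg fun y => abs_nonneg _)
  rw [show 1 / 2 * ∫ x, ∫ y, |T x - T y| ∂μ ∂μ = Real.sqrt ((1 / 2 * ∫ x, ∫ y, |T x - T y| ∂μ ∂μ) ^ 2)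
    from (Real.sqrt_sq h0).symm]
  exact Real.sqrt_le_sqrt (by linarith)

end Glasser

/-! ## §4 The sandwich -/

section Sandwich

variable {Ω : Type*} [MeasurableSpace Ω] {μ : Measure Ω} [IsProbabilityMeasure μ] {T : Ω → ℝ}

/-- **THE HALF GINI MEAN DIFFERENCE IS PINNED TO THE STANDARD DEVIATION**: for a measurable
`T ∈ L⁴(μ)` bounded below with fourth central moment `≤ 3(Var T)²`,
`√(Var T/6) ≤ ½·∫∫|T x − T y| dμ dμ ≤ √(Var T/3)`.  Read at the proposal law of an untrained exact
sampler, the middle term is the strong-coupling slope of its acceptance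
(`Scaling/IdentityFlowAcceptanceStrongCoupling`). [ours] -/
theorem gini_halfMeanDifference_sandwich (hTm : Measurable T) (hT : MemLp T 4 μ) {C : ℝ}
    (hC : ∀ x, C < T x) (hkurt : ∫ x, (T x - ∫ y, T y ∂μ) ^ 4 ∂μ ≤ 3 * (variance T μ) ^ 2) :
    Real.sqrt (variance T μ / 6) ≤ 1 / 2 * ∫ x, ∫ y, |T x - T y| ∂μ ∂μ
      ∧ 1 / 2 * ∫ x, ∫ y, |T x - T y| ∂μ ∂μ ≤ Real.sqrt (variance T μ / 3) :=
  ⟨sqrt_variance_div_six_le_half_integral_abs_sub hTm hT hkurt,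
    half_integral_abs_sub_le_sqrt_variance_div_three hTm (hT.mono_exponent (by norm_num)) hC⟩

end Sandwich

end Summit.Ventures.LatticeQCDFlow.Theory2

/-! ## §5 The mean absolute deviation: `E|T − E T| ≤ E|T − T′| ≤ 2·E|T − c|` -/

namespace Summit.Ventures.LatticeQCDFlow.Theory2

open MeasureTheory

section MeanAbsDeviation

variable {Ω : Type*} [MeasurableSpace Ω] {μ : Measure Ω} [IsProbabilityMeasure μ] {T : Ω → ℝ}

/-- **`E|T − E T| ≤ E_{μ⊗μ}|T − T′|`**: the mean difference dominates the mean absolute deviation about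
the mean (`|∫ (T x − T y) dμ(y)| ≤ ∫ |T x − T y| dμ(y)`), so `s = ½E|T − T′| ≥ ½·MAD`. [folklore] -/
theorem integral_abs_sub_mean_le_integral_integral_abs_sub (hT : Integrable T μ) :
    ∫ x, |T x - ∫ y, T y ∂μ| ∂μ ≤ ∫ x, ∫ y, |T x - T y| ∂μ ∂μ := by
  refine integral_mono_of_nonneg (ae_of_all _ fun x => abs_nonneg _)
    ((hT.comp_fst μ).sub (hT.comp_snd μ)).abs.integral_prod_left (ae_of_all _ fun x => ?_)
  calc |T x - ∫ y, T y ∂μ| = |∫ y, (T x - T y) ∂μ| := by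
        rw [integral_sub (integrable_const _) hT, integral_const, probReal_univ, one_smul]
    _ ≤ ∫ y, |T x - T y| ∂μ := abs_integral_le_integral_abs

/-- **`E_{μ⊗μ}|T − T′| ≤ 2·E|T − c|`** for every constant `c` (triangle inequality through `c`); with
`c = E T`: `½·MAD ≤ s ≤ MAD` for the half mean difference `s`. [folklore] -/
theorem integral_integral_abs_sub_le_two_mul_integral_abs_sub (hT : Integrable T μ) (c : ℝ) :
    ∫ x, ∫ y, |T x - T y| ∂μ ∂μ ≤ 2 * ∫ x, |T x - c| ∂μ := by
  have hi : Integrable (fun x => |T x - c|) μ := (hT.sub (integrable_const c)).abs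
  have hin : ∀ x, ∫ y, (|T x - c| + |T y - c|) ∂μ = |T x - c| + ∫ y, |T y - c| ∂μ := fun x => by
    rw [integral_add (integrable_const _) hi, integral_const, probReal_univ, one_smul]
  calc ∫ x, ∫ y, |T x - T y| ∂μ ∂μ ≤ ∫ x, ∫ y, (|T x - c| + |T y - c|) ∂μ ∂μ := by
        refine integral_mono ((hT.comp_fst μ).sub (hT.comp_snd μ)).abs.integral_prod_left
          ((hi.add (integrable_const _)).congr (ae_of_all _ fun x => (hin x).symm)) fun x => ?_
        refine integral_mono (((integrable_const (T x)).sub hT).abs) ((integrable_const _).add hi)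
          fun y => ?_
        have h := abs_sub_le (T x) c (T y)
        rwa [abs_sub_comm c (T y)] at h
    _ = ∫ x, (|T x - c| + ∫ y, |T y - c| ∂μ) ∂μ := integral_congr_ae (ae_of_all _ hin)
    _ = 2 * ∫ x, |T x - c| ∂μ := by
        rw [integral_add hi (integrable_const _), integral_const, probReal_univ, one_smul]; ring

end MeanAbsDeviation

end Summit.Ventures.LatticeQCDFlow.Theory2
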